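import Literature.AlgebraicGeometry.HodgeTheory.FermatAokiSubvarietyStabilizer
import Mathlib.FieldTheory.KummerExtension
import HarnessLib

/-!
# The section `X^{p-1}ₘ ∩ V₊(e₁(xᵈ), …, e_r(xᵈ))` is the union of the `d` translates `Y_{cζ}` of Aoki's `Y`, and `g_a⁻¹ Y_c = Y_{c·a₀⋯a_{p-1}/a_pᵖ}`

Family `hodge`, layer `Literature/AlgebraicGeometry/HodgeTheory`. PROOF FILE (theorems only; sequel of
`FermatAokiSubvarietyStabilizer`) for the leaf `Aoki1987_thm_2_1_supportedClass` of
`Aoki1987_claim_pStandard` — N. Aoki, J. Math. Soc. Japan 39 (1987), §3 (p. 390): in `ℂ[x₀, …, x_p]`,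
`p = 2r + 1`, `m = pd`, `cᵈ = -p`,
`x₀ᵐ + ⋯ + x_pᵐ = f₁g₁ + ⋯ + f_rg_r + (x_p^{pd} + p (x₀⋯x_{p-1})ᵈ)` and
"`x_p^{pd} + p(x₀⋯x_{p-1})ᵈ = ∏_{ζᵈ = 1} f_{0,ζ}`, `f_{0,ζ} = x_pᵖ - ζ c x₀⋯x_{p-1}`" — so that on the
Fermat variety the common zero locus of `f_k = e_k(x₀ᵈ, …, x_{p-1}ᵈ)` (`1 ≤ k ≤ r`) is the union of the
`d` varieties `Y_{cζ}` (2.1), the translates of `Y = Y_c` under `x_p ↦ ξ x_p`. This is the geometric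
input "a complete-intersection section of `X` is the sum of `d` translates of `Y`" of the orbit-sum /
restriction method for Thm. 2-1 (as the plane sections of the Fermat surface are sums of `m` lines).

* `Aoki1987.sum_pow_sub_mul_prod_mem_span_esymm` — (3.1)–(3.2): `Σ_{i<p} xᵢ^{pd} - p ∏_{i<p} xᵢᵈ ∈ (f₁, …, f_r)`;
* `Aoki1987.pow_add_mul_prod_eq_prod_f0` — `x_p^{pd} + p ∏ xᵢᵈ = ∏_{k<d} (x_pᵖ - cζᵏ·x₀⋯x_{p-1})` for
  `cᵈ = -p` and `ζ` a primitive `d`-th root of unity (Mathlib `X_pow_sub_C_eq_prod`);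
* **`Aoki1987.preimage_zeroLocus_esymm_eq_iUnion`** — `X^{p-1}ₘ ∩ V₊(f₁, …, f_r) = ⋃_{k<d} (Y_{cζᵏ} ∩ X^{p-1}ₘ)`
  (`fermatAokiSection`; a homogeneous prime containing the Fermat form and the `f_k` contains the
  product of the `f_{0,ζᵏ}`, hence one of them);
* `Aoki1987.aeval_diagonalSubst_f0_eq` — `σ_a f₀(c) = a_pᵖ · f₀(c·a₀⋯a_{p-1}/a_pᵖ)` for every diagonal
  substitution `a`, and **`Aoki1987.preimage_fermatAokiSection_diagonalAut_eq`** — for `a` in the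
  diagonal stabiliser with `a₀ᵈ = ⋯ = a_{p-1}ᵈ` (`g_a ∈ G₀`): `g_a⁻¹(Y_c ∩ X) = Y_{c a₀⋯a_{p-1}/a_pᵖ} ∩ X`
  — the translates `Y_{cζ}` are images of `Y` under the diagonal symmetries (generalising
  `preimage_fermatAokiSection_diagonalAut`, the case `a_pᵖ = a₀⋯a_{p-1}`).

## References

* [Aoki1987] N. Aoki, Some new algebraic cycles on Fermat varieties, J. Math. Soc. Japan 39 (1987)
  385–396: (2.1) (p. 388), §3 (3.1)–(3.3) and the proof of Prop. 3-1 (pp. 389–390).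
-/

noncomputable section

open CategoryTheory AlgebraicGeometry MvPolynomial Finset

namespace Literature.AlgebraicGeometry.HodgeTheory

open Literature.AlgebraicGeometry.Motives

namespace Aoki1987

/-! ### (3.1)–(3.2) under `yᵢ ↦ xᵢᵈ`, and the factorisation of `x_p^{pd} + p (x₀⋯x_{p-1})ᵈ` -/

section Algebra

variable {R : Type*} [CommRing R]

/-- **`Σ_{i<p} xᵢ^{pd} - p·x₀ᵈ⋯x_{p-1}ᵈ ∈ (f₁, …, f_r)`**, `f_k = e_k(x₀ᵈ, …, x_{p-1}ᵈ)`: the image under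
`yᵢ ↦ xᵢᵈ` of Newton's `p_p - p e_p ∈ (e₁, …, e_r)` (`psum_sub_mul_esymm_mem_span_esymm`).
[cite: Aoki1987, (3.1)–(3.2) (p. 390)] -/
theorem sum_pow_sub_mul_prod_mem_span_esymm (r d : ℕ) :
    (∑ i : Fin (2 * r + 1), (X (Fin.castSucc i) : MvPolynomial (Fin (2 * r + 2)) R) ^ ((2 * r + 1) * d)) -
        ((2 * r + 1 : ℕ) : MvPolynomial (Fin (2 * r + 2)) R) *
          ∏ i : Fin (2 * r + 1), (X (Fin.castSucc i) : MvPolynomial (Fin (2 * r + 2)) R) ^ d ∈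
      Ideal.span ((fun j ↦ aeval (fun i : Fin (2 * r + 1) ↦
          (X (Fin.castSucc i) : MvPolynomial (Fin (2 * r + 2)) R) ^ d) (esymm (Fin (2 * r + 1)) R j)) ''
        Set.Icc 1 r) := by
  set p := 2 * r + 1 with hp
  set φ : MvPolynomial (Fin p) R →ₐ[R] MvPolynomial (Fin (p + 1)) R :=
    aeval (fun i : Fin p ↦ (X (Fin.castSucc i) : MvPolynomial (Fin (p + 1)) R) ^ d) with hφ
  set I : Ideal (MvPolynomial (Fin p) R) := Ideal.span ((fun j ↦ esymm (Fin p) R j) '' Set.Icc 1 r)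
    with hI
  have hIJ : I.map φ ≤ Ideal.span ((fun j ↦ φ (esymm (Fin p) R j)) '' Set.Icc 1 r) := by
    rw [hI, Ideal.map_span]
    refine Ideal.span_mono ?_
    rintro _ ⟨_, ⟨j, hj, rfl⟩, rfl⟩
    exact ⟨j, hj, rfl⟩
  have hmem := hIJ (Ideal.mem_map_of_mem φ (psum_sub_mul_esymm_mem_span_esymm (Fin p) R r))
  have hφ' : φ (psum (Fin p) R p - (p : MvPolynomial (Fin p) R) * esymm (Fin p) R p) =
      (∑ i : Fin p, (X (Fin.castSucc i) : MvPolynomial (Fin (p + 1)) R) ^ (p * d)) -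
        (p : MvPolynomial (Fin (p + 1)) R) * ∏ i : Fin p, X (Fin.castSucc i) ^ d := by
    rw [map_sub, map_mul, map_natCast, psum, map_sum, esymm_fin_self, map_prod]
    simp only [hφ, map_pow, aeval_X, ← pow_mul, mul_comm d p]
  rw [hφ'] at hmem
  exact hmem

/-- **`x_p^{pd} + p (x₀⋯x_{p-1})ᵈ = ∏_{k<d} (x_pᵖ - c ζᵏ x₀⋯x_{p-1})`** for `cᵈ = -p` and `ζ` a primitive
`d`-th root of unity (`d ≥ 1`): `Tᵈ - αᵈ = ∏ (T - ζᵏ α)` at `T = x_pᵖ`, `α = c x₀⋯x_{p-1}`, with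
`αᵈ = -p (x₀⋯x_{p-1})ᵈ`. [cite: Aoki1987, §3 (p. 390: x_p^{pd} + p(x₀⋯x_{p-1})ᵈ = ∏_ζ f_{0,ζ})] -/
theorem pow_add_mul_prod_eq_prod_f0 (r d : ℕ) (hd : 0 < d) {c ζ : ℂ} (hc : c ^ d = -((2 * r + 1 : ℕ) : ℂ))
    (hζ : IsPrimitiveRoot ζ d) :
    (X (Fin.last (2 * r + 1)) : MvPolynomial (Fin (2 * r + 2)) ℂ) ^ ((2 * r + 1) * d) +
        ((2 * r + 1 : ℕ) : MvPolynomial (Fin (2 * r + 2)) ℂ) *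
          ∏ i : Fin (2 * r + 1), (X (Fin.castSucc i) : MvPolynomial (Fin (2 * r + 2)) ℂ) ^ d =
      ∏ k ∈ Finset.range d, (X (Fin.last (2 * r + 1)) ^ (2 * r + 1) -
        C (c * ζ ^ k) * ∏ i : Fin (2 * r + 1), (X (Fin.castSucc i) : MvPolynomial (Fin (2 * r + 2)) ℂ)) := by
  set α : MvPolynomial (Fin (2 * r + 2)) ℂ := C c * ∏ i : Fin (2 * r + 1), X (Fin.castSucc i) with hα
  have hζ' : IsPrimitiveRoot (C ζ : MvPolynomial (Fin (2 * r + 2)) ℂ) d :=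
    hζ.map_of_injective (C_injective _ _)
  have key := X_pow_sub_C_eq_prod hζ' hd (rfl : α ^ d = α ^ d)
  have h := congrArg (Polynomial.eval ((X (Fin.last (2 * r + 1)) : MvPolynomial (Fin (2 * r + 2)) ℂ) ^ (2 * r + 1))) key
  rw [Polynomial.eval_sub, Polynomial.eval_pow, Polynomial.eval_X, Polynomial.eval_C, Polynomial.eval_prod] at h
  simp only [Polynomial.eval_sub, Polynomial.eval_X, Polynomial.eval_C] at h
  have heq : ((X (Fin.last (2 * r + 1)) : MvPolynomial (Fin (2 * r + 2)) ℂ) ^ (2 * r + 1)) ^ d - α ^ d =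
      X (Fin.last (2 * r + 1)) ^ ((2 * r + 1) * d) + ((2 * r + 1 : ℕ) : MvPolynomial (Fin (2 * r + 2)) ℂ) *
        ∏ i : Fin (2 * r + 1), X (Fin.castSucc i) ^ d := by
    rw [← pow_mul, hα, mul_pow, ← map_pow, hc, Finset.prod_pow, map_neg, map_natCast]
    ring
  rw [← heq, h]
  refine Finset.prod_congr rfl fun k _ ↦ ?_
  rw [hα, map_mul, map_pow]
  ring

/-- **`σ_a f₀(c) = a_pᵖ · f₀(c a₀⋯a_{p-1}/a_pᵖ)`** for every diagonal substitution `σ_a : xᵢ ↦ aᵢ xᵢ`: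
`σ_a(x_pᵖ - c x₀⋯x_{p-1}) = a_pᵖ x_pᵖ - c a₀⋯a_{p-1} x₀⋯x_{p-1}`.
[cite: Aoki1987, proof of Prop. 3-1 (ii) (p. 390: the equation x_pᵖ - σ(g) c x₀⋯x_{p-1} = 0 of Yᵍ)] -/
theorem aeval_diagonalSubst_f0_eq (r : ℕ) (a : Fin (2 * r + 2) → ℂˣ) (c : ℂ) :
    aeval (diagonalSubst a)
        (X (Fin.last (2 * r + 1)) ^ (2 * r + 1) - C c * ∏ i : Fin (2 * r + 1), X (Fin.castSucc i) :
          MvPolynomial (Fin (2 * r + 2)) ℂ) =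
      C ((a (Fin.last (2 * r + 1)) : ℂ) ^ (2 * r + 1)) *
        (X (Fin.last (2 * r + 1)) ^ (2 * r + 1) -
          C (c * (∏ i : Fin (2 * r + 1), (a (Fin.castSucc i) : ℂ)) * (((a (Fin.last (2 * r + 1)) : ℂ) ^ (2 * r + 1)))⁻¹) *
            ∏ i : Fin (2 * r + 1), X (Fin.castSucc i)) := by
  have hu : ((a (Fin.last (2 * r + 1)) : ℂ) ^ (2 * r + 1)) ≠ 0 := pow_ne_zero _ (a _).ne_zero
  rw [map_sub, map_mul, map_pow, map_prod, aeval_C, algebraMap_eq]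
  simp_rw [aeval_X, diagonalSubst_apply]
  rw [Finset.prod_mul_distrib, ← map_prod, mul_pow, ← map_pow, mul_sub, ← mul_assoc, ← map_mul,
    ← mul_assoc (C _) (C _), ← map_mul]
  congr 2
  · congr 1
    field_simp

end Algebra

/-! ### The section `X ∩ V₊(f₁, …, f_r)` is the union of the `d` translates of `Y` -/

section Decomposition

variable {m : ℕ}

/-- **`X^{p-1}ₘ ∩ V₊(f₁, …, f_r) = ⋃_{k<d} (Y_{cζᵏ} ∩ X^{p-1}ₘ)`** (`m = pd`, `cᵈ = -p`, `ζ` a primitive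
`d`-th root of unity, `d ≥ 1`): the relevant homogeneous prime of a point of `X ∩ V₊(f₁, …, f_r)` contains
the Fermat form and the `f_k`, hence (by (3.1)–(3.2)) `x_p^{pd} + p (x₀⋯x_{p-1})ᵈ = ∏_k f_{0,ζᵏ}`, hence
one of the `f_{0,ζᵏ} = x_pᵖ - cζᵏ x₀⋯x_{p-1}`, i.e. the point lies on `Y_{cζᵏ}`; conversely each
`Y_{cζᵏ}` lies in `V₊(f₁, …, f_r)`. [cite: Aoki1987, (2.1) (p. 388) and §3 (pp. 389–390)] -/
theorem preimage_zeroLocus_esymm_eq_iUnion (r d : ℕ) (hm : m = (2 * r + 1) * d) (hd : 0 < d) {c ζ : ℂ}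
    (hc : c ^ d = -((2 * r + 1 : ℕ) : ℂ)) (hζ : IsPrimitiveRoot ζ d) :
    letI := MvPolynomial.gradedAlgebra (σ := Fin (2 * r + 2)) (R := ℂ)
    (SmoothHypersurface.hypersurfaceι (fermatPolynomial ℂ (2 * r) m)).left.base ⁻¹'
        ProjectiveSpectrum.zeroLocus (MvPolynomial.homogeneousSubmodule (Fin (2 * r + 2)) ℂ)
          ((fun j ↦ aeval (fun i : Fin (2 * r + 1) ↦
              (X (Fin.castSucc i) : MvPolynomial (Fin (2 * r + 2)) ℂ) ^ d) (esymm (Fin (2 * r + 1)) ℂ j)) ''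
            Set.Icc 1 r) =
      ⋃ k ∈ Finset.range d, fermatAokiSection m r d (c * ζ ^ k) := by
  letI := MvPolynomial.gradedAlgebra (σ := Fin (2 * r + 2)) (R := ℂ)
  let 𝒜 := MvPolynomial.homogeneousSubmodule (Fin (2 * r + 2)) ℂ
  let E : Set (MvPolynomial (Fin (2 * r + 2)) ℂ) := (fun j ↦ aeval (fun i : Fin (2 * r + 1) ↦
      (X (Fin.castSucc i) : MvPolynomial (Fin (2 * r + 2)) ℂ) ^ d) (esymm (Fin (2 * r + 1)) ℂ j)) ''
    Set.Icc 1 r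
  have hEsub : ∀ c' : ℂ, E ⊆ aokiEquations r d c' := fun c' s hs ↦ Set.mem_insert_of_mem _ hs
  ext z
  simp only [Set.mem_preimage, Set.mem_iUnion, Finset.mem_range, exists_prop]
  constructor
  · intro hz
    -- the homogeneous prime of `ι z` contains the `f_k` and the Fermat form
    let w : ↥(projectiveSpace (2 * r + 1) ℂ).left :=
      (SmoothHypersurface.hypersurfaceι (fermatPolynomial ℂ (2 * r) m)).left.base z
    let P : Ideal (MvPolynomial (Fin (2 * r + 2)) ℂ) :=
      ((w : ProjectiveSpectrum 𝒜).asHomogeneousIdeal).toIdeal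
    haveI hPprime : P.IsPrime := (w : ProjectiveSpectrum 𝒜).isPrime
    have hEP : E ⊆ (P : Set (MvPolynomial (Fin (2 * r + 2)) ℂ)) :=
      (ProjectiveSpectrum.mem_zeroLocus _ _ _).mp hz
    have hF : fermatPolynomial ℂ (2 * r) m ∈ P := by
      have hwF : w ∈ ProjectiveSpectrum.zeroLocus 𝒜 {fermatPolynomial ℂ (2 * r) m} :=
        (Set.ext_iff.mp (SmoothHypersurface.range_hypersurfaceι (fermatPolynomial ℂ (2 * r) m)) w).mp ⟨z, rfl⟩
      exact (ProjectiveSpectrum.mem_zeroLocus _ _ _).mp hwF (Set.mem_singleton _)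
    -- hence `x_p^{pd} + p (x₀⋯x_{p-1})ᵈ ∈ P`
    have hA : (∑ i : Fin (2 * r + 1), (X (Fin.castSucc i) : MvPolynomial (Fin (2 * r + 2)) ℂ) ^ ((2 * r + 1) * d)) -
        ((2 * r + 1 : ℕ) : MvPolynomial (Fin (2 * r + 2)) ℂ) *
          ∏ i : Fin (2 * r + 1), (X (Fin.castSucc i) : MvPolynomial (Fin (2 * r + 2)) ℂ) ^ d ∈ P :=
      (Ideal.span_le.mpr hEP) (sum_pow_sub_mul_prod_mem_span_esymm r d)
    have hsplit : fermatPolynomial ℂ (2 * r) m =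
        ((∑ i : Fin (2 * r + 1), (X (Fin.castSucc i) : MvPolynomial (Fin (2 * r + 2)) ℂ) ^ ((2 * r + 1) * d)) -
          ((2 * r + 1 : ℕ) : MvPolynomial (Fin (2 * r + 2)) ℂ) *
            ∏ i : Fin (2 * r + 1), (X (Fin.castSucc i) : MvPolynomial (Fin (2 * r + 2)) ℂ) ^ d) +
        ((X (Fin.last (2 * r + 1)) : MvPolynomial (Fin (2 * r + 2)) ℂ) ^ ((2 * r + 1) * d) +
          ((2 * r + 1 : ℕ) : MvPolynomial (Fin (2 * r + 2)) ℂ) *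
            ∏ i : Fin (2 * r + 1), (X (Fin.castSucc i) : MvPolynomial (Fin (2 * r + 2)) ℂ) ^ d) := by
      subst hm
      change (∑ i : Fin (2 * r + 2), (X i : MvPolynomial (Fin (2 * r + 2)) ℂ) ^ ((2 * r + 1) * d)) = _
      rw [Fin.sum_univ_castSucc]
      ring
    have hB : (X (Fin.last (2 * r + 1)) : MvPolynomial (Fin (2 * r + 2)) ℂ) ^ ((2 * r + 1) * d) +
        ((2 * r + 1 : ℕ) : MvPolynomial (Fin (2 * r + 2)) ℂ) *
          ∏ i : Fin (2 * r + 1), (X (Fin.castSucc i) : MvPolynomial (Fin (2 * r + 2)) ℂ) ^ d ∈ P := by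
      have h := Ideal.sub_mem P hF hA
      rw [hsplit, add_sub_cancel_left] at h
      exact h
    -- a product of the `f_{0,ζᵏ}` lies in the prime `P`
    rw [pow_add_mul_prod_eq_prod_f0 r d hd hc hζ, Ideal.IsPrime.prod_mem_iff] at hB
    obtain ⟨k, hk, hfk⟩ := hB
    refine ⟨k, Finset.mem_range.mp hk, ?_⟩
    -- so `ι z ∈ V₊(aokiEquations r d (c ζᵏ))`
    change w ∈ aokiSubvariety r d (c * ζ ^ k)
    refine (ProjectiveSpectrum.mem_zeroLocus _ _ _).mpr fun s hs ↦ ?_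
    rcases Set.mem_insert_iff.mp hs with rfl | hs'
    · exact hfk
    · exact hEP hs'
  · rintro ⟨k, -, hk⟩
    have hk' : (SmoothHypersurface.hypersurfaceι (fermatPolynomial ℂ (2 * r) m)).left.base z ∈
        aokiSubvariety r d (c * ζ ^ k) := hk
    exact ProjectiveSpectrum.zeroLocus_anti_mono _ (hEsub (c * ζ ^ k)) hk'

/-- **`g_a⁻¹(Y_c ∩ X²ʳₘ) = Y_{c a₀⋯a_{p-1}/a_pᵖ} ∩ X²ʳₘ` for `a` in the diagonal stabiliser with
`a₀ᵈ = ⋯ = a_{p-1}ᵈ`** (`g_a ∈ G₀`; the case `a_pᵖ = a₀⋯a_{p-1}` is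
`preimage_fermatAokiSection_diagonalAut`): the translates `Y_{cζ}` of `Y` under `x_p ↦ ξ x_p`
(`ξ ∈ μₘ`, `ξ^{-p} = ζ`) and under all of `G₀`. The substituted equations generate the ideal of the
equations of `Y_{c'}`, `c' = c a₀⋯a_{p-1}/a_pᵖ` (`σ_a f_k = βᵏ f_k`, `σ_a f₀(c) = a_pᵖ f₀(c')`).
[cite: Aoki1987, proof of Prop. 3-1 (ii) (p. 390: "Yᵍ is defined by … x_pᵖ - σ(g) c x₀⋯x_{p-1} = 0")] -/
theorem preimage_fermatAokiSection_diagonalAut_eq (r d : ℕ) {a : Fin (2 * r + 2) → ℂˣ}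
    (ha : a ∈ diagonalStabilizer (fermatPolynomial ℂ (2 * r) m)) {β : ℂ}
    (hβ : ∀ i : Fin (2 * r + 1), ((a (Fin.castSucc i)) : ℂ) ^ d = β) (c : ℂ) :
    (diagonalAut (fermatPolynomial ℂ (2 * r) m) ha).left.base ⁻¹' fermatAokiSection m r d c =
      fermatAokiSection m r d
        (c * (∏ i : Fin (2 * r + 1), (a (Fin.castSucc i) : ℂ)) * (((a (Fin.last (2 * r + 1)) : ℂ) ^ (2 * r + 1)))⁻¹) := by
  letI := MvPolynomial.gradedAlgebra (σ := Fin (2 * r + 2)) (R := ℂ)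
  set c' : ℂ := c * (∏ i : Fin (2 * r + 1), (a (Fin.castSucc i) : ℂ)) *
    (((a (Fin.last (2 * r + 1)) : ℂ) ^ (2 * r + 1)))⁻¹ with hc'
  have hβ0 : β ≠ 0 := by
    rw [← hβ 0]
    exact pow_ne_zero _ (a (Fin.castSucc 0)).ne_zero
  have hu : ((a (Fin.last (2 * r + 1)) : ℂ) ^ (2 * r + 1)) ≠ 0 := pow_ne_zero _ (a _).ne_zero
  -- the substituted equations of `Y_c` and the equations of `Y_{c'}` generate the same ideal
  have h1 : aeval (diagonalSubst a) '' aokiEquations r d c ⊆ (Ideal.span (aokiEquations r d c') : Set _) := by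
    rintro _ ⟨s, hs, rfl⟩
    rcases hs with rfl | ⟨k, hk, rfl⟩
    · rw [aeval_diagonalSubst_f0_eq r a c]
      exact Ideal.mul_mem_left _ _ (Ideal.subset_span (f0_mem_aokiEquations r d c'))
    · change aeval (diagonalSubst a) (aeval _ (esymm (Fin (2 * r + 1)) ℂ k)) ∈ _
      rw [aeval_diagonalSubst_esymm r d hβ k]
      exact Ideal.mul_mem_left _ _ (Ideal.subset_span (esymm_mem_aokiEquations r d c' hk))
  have h2 : aokiEquations r d c' ⊆ (Ideal.span (aeval (diagonalSubst a) '' aokiEquations r d c) : Set _) := by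
    intro s hs
    rcases hs with rfl | ⟨k, hk, rfl⟩
    · have hmem : aeval (diagonalSubst a) (X (Fin.last (2 * r + 1)) ^ (2 * r + 1) -
          C c * ∏ i : Fin (2 * r + 1), X (Fin.castSucc i)) ∈
          Ideal.span (aeval (diagonalSubst a) '' aokiEquations r d c) :=
        Ideal.subset_span ⟨_, f0_mem_aokiEquations r d c, rfl⟩
      rw [aeval_diagonalSubst_f0_eq r a c] at hmem
      have h := Ideal.mul_mem_left _ (C (((a (Fin.last (2 * r + 1)) : ℂ) ^ (2 * r + 1)))⁻¹) hmem
      rwa [← mul_assoc, ← map_mul, inv_mul_cancel₀ hu, map_one, one_mul] at h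
    · have hmem : aeval (diagonalSubst a) (aeval (fun i : Fin (2 * r + 1) ↦
          (X (Fin.castSucc i) : MvPolynomial (Fin (2 * r + 2)) ℂ) ^ d) (esymm (Fin (2 * r + 1)) ℂ k)) ∈
          Ideal.span (aeval (diagonalSubst a) '' aokiEquations r d c) :=
        Ideal.subset_span ⟨_, esymm_mem_aokiEquations r d c hk, rfl⟩
      rw [aeval_diagonalSubst_esymm r d hβ k] at hmem
      have h := Ideal.mul_mem_left _ (C (β ^ k)⁻¹) hmem
      rwa [← mul_assoc, ← map_mul, inv_mul_cancel₀ (pow_ne_zero k hβ0), map_one, one_mul] at h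
  -- hence the same projective zero locus
  have hproj : (diagonalProjMap a).left.base ⁻¹' aokiSubvariety r d c = aokiSubvariety r d c' := by
    change (diagonalProjMap a).left.base ⁻¹'
        ProjectiveSpectrum.zeroLocus (MvPolynomial.homogeneousSubmodule (Fin (2 * r + 2)) ℂ) (aokiEquations r d c) =
      ProjectiveSpectrum.zeroLocus (MvPolynomial.homogeneousSubmodule (Fin (2 * r + 2)) ℂ) (aokiEquations r d c')
    rw [diagonalProjMap_preimage_zeroLocus]
    refine Set.Subset.antisymm ?_ ?_
    · rw [← ProjectiveSpectrum.zeroLocus_span _ (aeval (diagonalSubst a) '' aokiEquations r d c)]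
      exact ProjectiveSpectrum.zeroLocus_anti_mono _ h2
    · rw [← ProjectiveSpectrum.zeroLocus_span _ (aokiEquations r d c')]
      exact ProjectiveSpectrum.zeroLocus_anti_mono _ h1
  -- and the same trace on `X`
  have hcomp : ∀ z : ↥(fermatHypersurface (2 * r) m).left,
      (SmoothHypersurface.hypersurfaceι (fermatPolynomial ℂ (2 * r) m)).left.base
          ((diagonalAut (fermatPolynomial ℂ (2 * r) m) ha).left.base z) =
        (diagonalProjMap a).left.base
          ((SmoothHypersurface.hypersurfaceι (fermatPolynomial ℂ (2 * r) m)).left.base z) := by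
    intro z
    have h := congrArg (fun f ↦ f.base z) (diagonalAut_left_comp_ι (fermatPolynomial ℂ (2 * r) m) ha)
    simpa using h
  ext z
  simp only [fermatAokiSection, Set.mem_preimage, hcomp]
  rw [← Set.mem_preimage, hproj]

end Decomposition

end Aoki1987

end Literature.AlgebraicGeometry.HodgeTheory

end
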